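import Summits.BirchSwinnertonDyer.BirchSwinnertonDyer.Theorems.ByReductionTypeAtTwoSupersingularThetaHabitat
import Summits.BirchSwinnertonDyer.BirchSwinnertonDyer.Theorems.ThetaPartnerAtTwoTwoTorsionCongruence
import Summits.BirchSwinnertonDyer.BirchSwinnertonDyer.Theorems.ByReductionTypeAtTwoSupersingularColemanClassKit
import Literature.NumberTheory.EllipticCurves.ComplexMultiplicationHasCMThirteenProofs
import HarnessLib

/-!
# Route `ByReductionTypeAtTwo` (rung K4), crux `SupersingularRankZeroAtTwo` (item stmt-BirchSwinnertonDyer-19097):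
# the THETA-HABITAT CLASS-INSTANCE KIT — BSD₂ of a habitat curve from TP2's items (or from 19097's stubs
# (1)(1′)(2′)(4) + K1 + K2r0) with the CM partner and the `E[2] ≅ A[2]` congruence KERNEL-DECIDED per class
# (seat `bsd-2adic-ss-1x`; one display theorem per class file `…SupersingularThetaClass<cls>.lean`)

HONEST FRAMING (cell `bsd-2adic`, run/shared/lean/pub/bsd-2adic/, HUMAN RULINGS D-0036/D-0054/D-0074): THEOREMS ONLY — no
definition, no named fact, no instance, no `sorry`; closes none; nothing booked; BSD is NOT proved by any of this. PARTITION
(D-0054): X5@2 good-SUPERSINGULAR, `a₂ = 0` THETA-HABITAT sub-row (19 of the 208 rank-`0` `a₂ = 0` census classes) × `p = 2` —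
types-the-object-of (item 19097 AT a habitat class); bears_on: K4-leaf 19097 · TP2 K1/K2r0/K3/K4 (20333/20312/20308/20309).

## What the kit provides

* `aeval_twoTorsionPolynomial_baseChange_int`, `aeval_quadratic` — evaluation in `ℚ̄` of the `2`-division cubic
  `4x³ + b₂x² + 2b₄x + b₆` of an integer model and of a quadratic Tschirnhaus polynomial `c₀ + c₁x + c₂x²`, so that a
  class file checks its two certificate congruences by `push_cast; linear_combination`.
* `bsdp_two_baseChange_int_of_thetaPartner` — THE DOOR (RC-138 (3) interface): for integer models `M_E` (the habitat
  curve: non-CM, `L(E,1) ≠ 0`, good supersingular at `2`, `a₂ = 0`) and `M_A` (the CM partner: CM, `L(A,1) ≠ 0`, good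
  supersingular at `2`, `a₂ = 0`), a Tschirnhaus pair `(q, r)` certifying `E[2] ≅ A[2]`
  (`ThetaPartnerXRoute.exists_equivariant_addEquiv_geomTorsion_two_of_tschirnhaus`), modularity + GZK (PUB) and TP2's four
  K-items K1 `SignedTransportAtTwo`, K2r0 `SignedMainConjectureCMTwoRankZero`, K3 `SignedKatoDivisibilityUpToAtTwo`, K4
  `SignedControlAtTwo` BY NAME ⟹ `BSDp (M_E ⊗ ℚ) 2` (via `ThetaPartnerXRoute.bsdp_two_of_cmPartner_of_thetaPartnerItems`).
* `bsdp_two_baseChange_int_of_signedTransport_of_stubs` — the same with K3/K4 replaced by 19097's registered stubs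
  (1′) `stub_katoPub`, (2′) `stub_zeroSignedEulerChar`, (4) `stub_zeroColemanKato` (and (1) `stub_ssPub` for PUB), K1 + K2r0
  kept (via `ThetaPartnerXRoute.bsdp_two_of_cmPartner_of_signedTransport_of_stubs`).

The certificates `L(E,1) ≠ 0`, `L(A,1) ≠ 0` stay displayed (`hL`, `hLA`: Cremona's allbsd / the cell's local-series values,
HABITAT-CENSUS-TP2-v1.1); everything else about the two curves is kernel-decided in the class file.

References: [SilvermanAEC2009] III.§1, VII.1 Rem. 1.1, VII.5 Prop. 5.1, App. C §11; [Kobayashi2003] Thm. 1.2, 4.1;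
[BDKim2013] Cor. 3.15; [GreenbergVatsal2000] Thm. (1.4); [PollackRubin2004] Thm. 7.3; [Miller2011LMS] Def. 1.1;
HABITAT-CENSUS-TP2-v1.md / v1.1 (bsd-wall-p2); kit job j277974 (Tschirnhaus data, seat bsd-2adic-ss-1x).
-/

set_option autoImplicit false
-- the Theorems namespace of this sub repeats the summit name by design (D-0017 nested layout)
set_option linter.dupNamespace false

noncomputable section

open scoped Classical Polynomial

open CongruenceSubgroup WeierstrassCurve Literature.NumberTheory.EllipticCurves
  Literature.NumberTheory.EllipticCurves.ModularForms
  Literature.NumberTheory.EllipticCurves.Rank1Residual Literature.NumberTheory.EllipticCurves.Rank1Residual.Typed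
  Literature.NumberTheory.EllipticCurves.Kobayashi2003 Literature.NumberTheory.EllipticCurves.IwasawaDual
  ZpExtension Summit.BirchSwinnertonDyer.Rank1Residual Summit.BirchSwinnertonDyer.Rank1Residual.Supersingular
  Summit.BirchSwinnertonDyer.Rank1Residual.X5 Summit.BirchSwinnertonDyer.Rank1Residual.X5.O1
  Summit.BirchSwinnertonDyer.Rank1Residual.X5.Instances
  Summit.BirchSwinnertonDyer.BirchSwinnertonDyer.Theses.ThetaPartnerAtTwo

namespace Summit.BirchSwinnertonDyer.BirchSwinnertonDyer.Theorems
namespace SSThetaRoad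

/-! ## §1 Evaluation lemmas for the per-class certificate congruences -/

/-- The `2`-division cubic `4x³ + b₂x² + 2b₄x + b₆` of an integer model `M`, base-changed to `ℚ` and evaluated at
`ξ ∈ ℚ̄`. [cite: SilvermanAEC2009, III.§1] -/
theorem aeval_twoTorsionPolynomial_baseChange_int (M : WeierstrassCurve ℤ) (ξ : AlgebraicClosure ℚ) :
    Polynomial.aeval ξ (M.baseChange ℚ).twoTorsionPolynomial.toPoly =
      4 * ξ ^ 3 + (M.b₂ : AlgebraicClosure ℚ) * ξ ^ 2 + 2 * (M.b₄ : AlgebraicClosure ℚ) * ξ +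
        (M.b₆ : AlgebraicClosure ℚ) := by
  simp only [twoTorsionPolynomial, Cubic.toPoly, WeierstrassCurve.baseChange, map_b₂, map_b₄, map_b₆,
    map_add, map_mul, Polynomial.aeval_X, map_pow, map_ofNat, algebraMap_int_eq,
    eq_intCast, map_intCast]

/-- A quadratic polynomial `c₀ + c₁x + c₂x²` over `ℚ` evaluated at `ξ ∈ ℚ̄`. [folklore] -/
theorem aeval_quadratic (c₀ c₁ c₂ : ℚ) (ξ : AlgebraicClosure ℚ) :
    Polynomial.aeval ξ (Polynomial.C c₀ + Polynomial.C c₁ * Polynomial.X + Polynomial.C c₂ * Polynomial.X ^ 2) =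
      (c₀ : AlgebraicClosure ℚ) + (c₁ : AlgebraicClosure ℚ) * ξ + (c₂ : AlgebraicClosure ℚ) * ξ ^ 2 := by
  simp only [map_add, map_mul, map_pow, Polynomial.aeval_C, Polynomial.aeval_X, eq_ratCast]

/-- `ℚ̄` has characteristic zero (so `linear_combination` may divide by numerals). [folklore] -/
theorem charZero_algebraicClosure_rat : CharZero (AlgebraicClosure ℚ) :=
  charZero_of_injective_algebraMap (algebraMap ℚ (AlgebraicClosure ℚ)).injective

/-! ## §2 The doors: BSD₂ of a habitat curve from its certified CM partner -/

section Door

variable (ME MA : WeierstrassCurve ℤ)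
  [(ME.baseChange ℚ).IsElliptic] [(ME.baseChange ℚ).IsGloballyMinimal]
  [(MA.baseChange ℚ).IsElliptic] [(MA.baseChange ℚ).IsGloballyMinimal]

/-- **THE DOOR (TP2 items by name).** `M_E ⊗ ℚ` non-CM with `L(E,1) ≠ 0`, good supersingular at `2`, `a₂ = 0`;
`M_A ⊗ ℚ` CM with `L(A,1) ≠ 0`, good supersingular at `2`, `a₂ = 0`; a Tschirnhaus pair `(q, r)` on the `2`-division
cubics certifying `E[2] ≅ A[2]` as Galois modules; modularity and GZK (PUB); TP2's K1, K2r0, K3, K4 BY NAME ⟹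
`BSDp (M_E ⊗ ℚ) 2`. [cite: GreenbergVatsal2000, Thm. (1.4)] [cite: Kobayashi2003, Thm. 1.2 and Thm. 4.1]
[cite: BDKim2013, Cor. 3.15] [cite: SilvermanAEC2009, III.§1 and Cor. III.6.4(b)] [cite: Miller2011LMS, Def. 1.1] -/
theorem bsdp_two_baseChange_int_of_thetaPartner
    (hmod : nonempty_modularParametrizationData) (hGZK : rank_eq_analyticRank_of_analyticRank_le_one)
    (hT : SignedTransportAtTwo) (hCM : SignedMainConjectureCMTwoRankZero)
    (hKato : SignedKatoDivisibilityUpToAtTwo) (hStr : SignedControlAtTwo)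
    (hcm : ¬ (ME.baseChange ℚ).HasCM) (hL : (ME.baseChange ℚ).entireLFunction 1 ≠ 0)
    (hss : GoodSS (ME.baseChange ℚ) 2) (ha : (ME.baseChange ℚ).frobeniusTrace 2 = 0)
    (hAcm : (MA.baseChange ℚ).HasCM) (hLA : (MA.baseChange ℚ).entireLFunction 1 ≠ 0)
    (hAss : GoodSS (MA.baseChange ℚ) 2) (hAa : (MA.baseChange ℚ).frobeniusTrace 2 = 0)
    (q r : ℚ[X])
    (hroot : ∀ ξ : AlgebraicClosure ℚ, Polynomial.aeval ξ (ME.baseChange ℚ).twoTorsionPolynomial.toPoly = 0 →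
      Polynomial.aeval (Polynomial.aeval ξ q) (MA.baseChange ℚ).twoTorsionPolynomial.toPoly = 0)
    (hinv : ∀ ξ : AlgebraicClosure ℚ, Polynomial.aeval ξ (ME.baseChange ℚ).twoTorsionPolynomial.toPoly = 0 →
      Polynomial.aeval (Polynomial.aeval ξ q) r = ξ) :
    BSDp (ME.baseChange ℚ) 2 := by
  obtain ⟨e, he⟩ := ThetaPartnerXRoute.exists_equivariant_addEquiv_geomTorsion_two_of_tschirnhaus (K := ℚ)
    two_ne_zero (ME.baseChange ℚ) (MA.baseChange ℚ) q r hroot hinv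
  exact ThetaPartnerXRoute.bsdp_two_of_cmPartner_of_thetaPartnerItems hmod hGZK hT hCM hKato hStr
    (ME.baseChange ℚ) hcm (analyticRank_eq_zero_of_entireLFunction_one_ne_zero _ hL) hss ha
    (MA.baseChange ℚ) hAcm (analyticRank_eq_zero_of_entireLFunction_one_ne_zero _ hLA) hAss hAa e he

/-- **THE DOOR (19097's stubs (1)(1′)(2′)(4) + TP2's K1, K2r0).** Same inputs on the two curves and the congruence;
binders: `hPub` = stub (1) `stub_ssPub`, `hKatoPub` = stub (1′) `stub_katoPub`, `hEC` = stub (2′) `stub_zeroSignedEulerChar`,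
`hCK` = stub (4) `stub_zeroColemanKato` (v8/v9 signatures VERBATIM), K1 `SignedTransportAtTwo`, K2r0
`SignedMainConjectureCMTwoRankZero` ⟹ `BSDp (M_E ⊗ ℚ) 2` — the hardest stub (3) and the conjecture stub (4′) are not used.
[cite: GreenbergVatsal2000, Thm. (1.4)] [cite: Kobayashi2003, Thm. 1.2, Thm. 4.1 and §7] [cite: BDKim2013, Cor. 3.15]
[cite: Kato2004Asterisque, Thm. 12.4–12.5] [cite: Miller2011LMS, Def. 1.1] -/
theorem bsdp_two_baseChange_int_of_signedTransport_of_stubs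
    (hPub : nonempty_modularParametrizationData ∧ rank_eq_analyticRank_of_analyticRank_le_one)
    (hKatoPub : Kato2004.thm12_4 ∧ Kato2004_fineSelmerDual_isTorsion)
    (hEC : ∀ (W : WeierstrassCurve ℚ) [W.IsElliptic] [W.IsGloballyMinimal],
        ¬ W.HasCM → W.analyticRank = 0 → GoodSS W 2 → W.frobeniusTrace 2 = 0 →
        ∀ (κ : ZpExtension ℚ 2) (γ : Field.absoluteGaloisGroup ℚ),
          κ.IsCyclotomic → κ.IsTopGenerator γ → Finite (W.selmerGroupPInfty 2) →
          Finite (endInvariants (conjSignedSelmerInfty W κ 1 γ - 1)) ∧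
            ∃ u : ℤ_[2]ˣ, (Nat.card (endInvariants (conjSignedSelmerInfty W κ 1 γ - 1)) : ℚ_[2]) =
              ((u : ℤ_[2]) : ℚ_[2]) * ((2 : ℕ) : ℚ_[2]) ^ (padicValNat 2 W.tamagawaProduct) *
                (Nat.card (W.selmerGroupPInfty 2) : ℚ_[2]) *
                  (Nat.card (EndCoinvariants (conjSignedSelmerInfty W κ 1 γ - 1)) : ℚ_[2]))
    (hCK : ∀ (W : WeierstrassCurve ℚ) [W.IsElliptic] [W.IsGloballyMinimal],
      ¬ W.HasCM → W.analyticRank = 0 → GoodSS W 2 → W.frobeniusTrace 2 = 0 →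
      ∀ (κ : ZpExtension ℚ 2) (γ : Field.absoluteGaloisGroup ℚ),
        κ.IsCyclotomic → κ.IsTopGenerator γ → IsCyclotomicVariable 2 γ →
        ∀ [NeZero (W.conductorNorm ℤ)] (f : CuspForm (Gamma0 (W.conductorNorm ℤ)) 2),
          IsNewformOf W f → ∀ (ϖ : ℚ), (ϖ : ℝ) * W.realPeriodRat = plusPeriod f →
        ∀ (Lplus Lminus : IwasawaAlgebra 2), IsPollackPair f 2 Lplus Lminus →
        ∀ (D : SignedSelmerDualData W κ γ 1) [ContinuousSMul ℤ_[2] (W.tateModule 2)],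
          ∃ (I : Kato2004.IwasawaH1Data W 2 κ γ) (Y : W.FineSelmerDualData κ γ)
            (P : Submodule (IwasawaAlgebra 2) (IwasawaAlgebra 2))
            (loc : I.H →ₗ[IwasawaAlgebra 2] P) (toX : P →ₗ[IwasawaAlgebra 2] D.X)
            (δ : D.X →ₗ[IwasawaAlgebra 2] Y.X) (Z : Submodule (IwasawaAlgebra 2) I.H)
            (G : IwasawaAlgebra 2),
            Function.Exact loc toX ∧ Function.Exact toX δ ∧
            G ∈ Submodule.map (P.subtype ∘ₗ loc) Z ∧
            iwasawaToPowerSeries 2 G =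
              PowerSeries.C (ϖ : ℚ_[2]) * iwasawaToPowerSeries 2 (kobayashiL 1 Lplus Lminus) ∧
            (∀ 𝔭 : PrimeSpectrum (IwasawaAlgebra 2), 𝔭.asIdeal.height = 1 →
              PowerSeries.C (2 : ℤ_[2]) ∉ 𝔭.asIdeal →
              Literature.NumberTheory.EllipticCurves.Module.lengthAt (IwasawaAlgebra 2) Y.X 𝔭 ≤
                Literature.NumberTheory.EllipticCurves.Module.lengthAt (IwasawaAlgebra 2) (I.H ⧸ Z) 𝔭) ∧
            (TwoAdicSurjective W →
              ∀ 𝔭 : PrimeSpectrum (IwasawaAlgebra 2), 𝔭.asIdeal.height = 1 →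
                PowerSeries.C (2 : ℤ_[2]) ∈ 𝔭.asIdeal →
                Literature.NumberTheory.EllipticCurves.Module.lengthAt (IwasawaAlgebra 2) Y.X 𝔭 ≤
                  Literature.NumberTheory.EllipticCurves.Module.lengthAt (IwasawaAlgebra 2) (I.H ⧸ Z) 𝔭))
    (hT : SignedTransportAtTwo) (hCM : SignedMainConjectureCMTwoRankZero)
    (hcm : ¬ (ME.baseChange ℚ).HasCM) (hL : (ME.baseChange ℚ).entireLFunction 1 ≠ 0)
    (hss : GoodSS (ME.baseChange ℚ) 2) (ha : (ME.baseChange ℚ).frobeniusTrace 2 = 0)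
    (hAcm : (MA.baseChange ℚ).HasCM) (hLA : (MA.baseChange ℚ).entireLFunction 1 ≠ 0)
    (hAss : GoodSS (MA.baseChange ℚ) 2) (hAa : (MA.baseChange ℚ).frobeniusTrace 2 = 0)
    (q r : ℚ[X])
    (hroot : ∀ ξ : AlgebraicClosure ℚ, Polynomial.aeval ξ (ME.baseChange ℚ).twoTorsionPolynomial.toPoly = 0 →
      Polynomial.aeval (Polynomial.aeval ξ q) (MA.baseChange ℚ).twoTorsionPolynomial.toPoly = 0)
    (hinv : ∀ ξ : AlgebraicClosure ℚ, Polynomial.aeval ξ (ME.baseChange ℚ).twoTorsionPolynomial.toPoly = 0 →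
      Polynomial.aeval (Polynomial.aeval ξ q) r = ξ) :
    BSDp (ME.baseChange ℚ) 2 := by
  obtain ⟨e, he⟩ := ThetaPartnerXRoute.exists_equivariant_addEquiv_geomTorsion_two_of_tschirnhaus (K := ℚ)
    two_ne_zero (ME.baseChange ℚ) (MA.baseChange ℚ) q r hroot hinv
  exact ThetaPartnerXRoute.bsdp_two_of_cmPartner_of_signedTransport_of_stubs hPub hKatoPub hEC hCK hT hCM
    (ME.baseChange ℚ) hcm (analyticRank_eq_zero_of_entireLFunction_one_ne_zero _ hL) hss ha
    (MA.baseChange ℚ) hAcm (analyticRank_eq_zero_of_entireLFunction_one_ne_zero _ hLA) hAss hAa e he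

end Door

end SSThetaRoad
end Summit.BirchSwinnertonDyer.BirchSwinnertonDyer.Theorems

end
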